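import Mathlib
import Literature.Computability.AlgebraicComplexity.SimultaneousDoubleProduct

/-!
# Triage k=3 — merge certificate: `kronecker-coupling`'s THEOREM `MultiplicityForcing` is a three-line
corollary of `low-multiplicity-removal-dichotomy`'s first lemma `LowMultiplicityRegime`

Both statements copied verbatim (the first from `Cruxes/PrimeDensityDecay/SketchK1.lean`, the second from the
card `kronecker-coupling.md` §First lemma).  Kernel-checked: `LowMultiplicityRegime → MultiplicityForcing`.
Argument: `coincidences = Σ_i Σ_{q ∈ A_i × B_i} mult(q)` where `mult(q) = D̃(q.1 - q.2)` is exactly the inner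
sum of `lowMass`; pointwise `mult q + (Ks+1)·[mult q ≤ Ks] ≥ Ks+1`, so
`coincidences + (Ks+1)·lowMass ≥ (Ks+1)·n s²`; if the family is dense (`ε p ≤ n s`), `LowMultiplicityRegime`
(with `K := ⌈2C⌉₊`, `ε/2`) forbids `n s² ≤ 2·lowMass`, hence `coincidences ≥ (Ks+1)·n s²/2 ≥ C s·n s²`.
-/

open scoped BigOperators
open Finset Literature.Computability.AlgebraicComplexity

namespace TriageK3

/-- verbatim from SketchK1.lean (card low-multiplicity-removal-dichotomy) -/
def lowMass {p n : ℕ} (K s : ℕ) (A B : Fin n → Finset (ZMod p)) : ℕ :=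
  ∑ i : Fin n, ((A i ×ˢ B i).filter (fun q : ZMod p × ZMod p =>
      (∑ j : Fin n, ((A j ×ˢ B j).filter
        (fun r : ZMod p × ZMod p => r.1 - r.2 = q.1 - q.2)).card) ≤ K * s)).card

/-- verbatim from SketchK1.lean (card low-multiplicity-removal-dichotomy) -/
def LowMultiplicityRegime : Prop :=
  ∀ (K : ℕ) (ε : ℝ), 0 < ε → ∃ s₀ : ℕ, ∀ p : ℕ, p.Prime → ∀ (n s : ℕ) (A B : Fin n → Finset (ZMod p)),
    s₀ ≤ s → (∀ i : Fin n, (A i).card = s ∧ (B i).card = s) →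
    (∀ i : Fin n, ∀ a ∈ A i, ∀ a' ∈ A i, ∀ b ∈ B i, ∀ b' ∈ B i, (a - a') + (b - b') = 0 → a = a' ∧ b = b') →
    (∀ i j k : Fin n, ∀ a ∈ A i, ∀ a' ∈ A j, ∀ b ∈ B j, ∀ b' ∈ B k, (a - a') + (b - b') = 0 → i = k) →
    n * s ^ 2 ≤ 2 * lowMass K s A B →
    (n : ℝ) * (s : ℝ) ≤ ε * (p : ℝ)

/-- verbatim from card kronecker-coupling (§First lemma): `Σ_d D(d)² = Σ_{i,j} T_{ij}` -/
def coincidences {p n : ℕ} (A B : Fin n → Finset (ZMod p)) : ℕ :=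
  ∑ i, ∑ j, (((A i ×ˢ B i) ×ˢ (A j ×ˢ B j)).filter fun q => q.1.1 - q.1.2 = q.2.1 - q.2.2).card

/-- verbatim from card kronecker-coupling (§First lemma): "THE THEOREM (first stub of the line)" -/
def MultiplicityForcing : Prop :=
  ∀ ε : ℝ, 0 < ε → ∀ C : ℝ, ∃ s₀ : ℕ, ∀ p : ℕ, p.Prime →
    ∀ (n s : ℕ) (A B : Fin n → Finset (ZMod p)), s₀ ≤ s →
      (∀ i, (A i).card = s ∧ (B i).card = s) → IsSDPP A B → ε * p ≤ n * s →
      C * s * (n * s ^ 2) ≤ (coincidences A B : ℝ)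

/-- sharing multiplicity of the difference of a matched pair: `D̃(q.1 - q.2)` -/
def mult {p n : ℕ} (A B : Fin n → Finset (ZMod p)) (q : ZMod p × ZMod p) : ℕ :=
  ∑ j : Fin n, ((A j ×ˢ B j).filter (fun r : ZMod p × ZMod p => r.1 - r.2 = q.1 - q.2)).card

theorem card_filter_product {α β : Type*} (S : Finset α) (T : Finset β) (R : α → β → Prop)
    [∀ a b, Decidable (R a b)] :
    ((S ×ˢ T).filter (fun q => R q.1 q.2)).card = ∑ a ∈ S, (T.filter (fun b => R a b)).card := by
  simp only [Finset.card_filter]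
  rw [Finset.sum_product]

theorem coincidences_eq {p n : ℕ} (A B : Fin n → Finset (ZMod p)) :
    coincidences A B = ∑ i, ∑ q ∈ A i ×ˢ B i, mult A B q := by
  unfold coincidences mult
  refine Finset.sum_congr rfl fun i _ => ?_
  rw [Finset.sum_comm]
  refine Finset.sum_congr rfl fun j _ => ?_
  rw [card_filter_product (A i ×ˢ B i) (A j ×ˢ B j) (fun q r => q.1 - q.2 = r.1 - r.2)]
  refine Finset.sum_congr rfl fun q _ => ?_
  congr 1
  ext r
  simp only [Finset.mem_filter, eq_comm]

theorem lowMass_eq {p n : ℕ} (K s : ℕ) (A B : Fin n → Finset (ZMod p)) :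
    lowMass K s A B = ∑ i, ∑ q ∈ A i ×ˢ B i, (if mult A B q ≤ K * s then 1 else 0) := by
  unfold lowMass mult
  refine Finset.sum_congr rfl fun i _ => ?_
  rw [Finset.card_filter]

theorem key_ineq {p n : ℕ} (K s : ℕ) (A B : Fin n → Finset (ZMod p))
    (hcard : ∀ i : Fin n, (A i).card = s ∧ (B i).card = s) :
    (K * s + 1) * (n * s ^ 2) ≤ coincidences A B + (K * s + 1) * lowMass K s A B := by
  have hns : n * s ^ 2 = ∑ i : Fin n, ∑ _q ∈ A i ×ˢ B i, 1 := by
    simp only [Finset.sum_const, smul_eq_mul, mul_one, Finset.card_product]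
    have : ∀ i : Fin n, (A i).card * (B i).card = s ^ 2 := fun i => by
      rw [(hcard i).1, (hcard i).2, sq]
    simp only [this, Finset.sum_const, Finset.card_univ, Fintype.card_fin, smul_eq_mul]
  rw [hns, coincidences_eq, lowMass_eq, Finset.mul_sum, Finset.mul_sum, ← Finset.sum_add_distrib]
  refine Finset.sum_le_sum fun i _ => ?_
  rw [Finset.mul_sum, Finset.mul_sum, ← Finset.sum_add_distrib]
  refine Finset.sum_le_sum fun q _ => ?_
  split_ifs with h
  · omega
  · push Not at h
    omega

/-- MERGE CERTIFICATE: card kronecker-coupling's theorem follows from card low-multiplicity-removal-dichotomy's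
first lemma. -/
theorem multiplicityForcing_of_lowMultiplicityRegime (hL : LowMultiplicityRegime) :
    MultiplicityForcing := by
  intro ε hε C
  set K : ℕ := ⌈2 * C⌉₊ with hK
  obtain ⟨s₀, hs₀⟩ := hL K (ε / 2) (by positivity)
  refine ⟨s₀, ?_⟩
  intro p hp n s A B hs hcard hS hdense
  have hp0 : (0 : ℝ) < p := by exact_mod_cast hp.pos
  by_cases hlow : n * s ^ 2 ≤ 2 * lowMass K s A B
  · have h1 := hs₀ p hp n s A B hs hcard hS.1 hS.2 hlow
    exfalso
    nlinarith [mul_pos hε hp0]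
  · push Not at hlow
    have h3 := key_ineq K s A B hcard
    have h3' : ((K : ℝ) * s + 1) * ((n : ℝ) * (s : ℝ) ^ 2) ≤
        (coincidences A B : ℝ) + ((K : ℝ) * s + 1) * (lowMass K s A B : ℝ) := by
      exact_mod_cast h3
    have hlow' : 2 * (lowMass K s A B : ℝ) < (n : ℝ) * (s : ℝ) ^ 2 := by
      exact_mod_cast hlow
    have hKC : 2 * C ≤ (K : ℝ) := Nat.le_ceil _
    have hs0 : (0 : ℝ) ≤ s := Nat.cast_nonneg _
    have hN0 : (0 : ℝ) ≤ (n : ℝ) * (s : ℝ) ^ 2 := by positivity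
    have hKs0 : (0 : ℝ) ≤ (K : ℝ) * s := by positivity
    -- coincidences ≥ (Ks+1)(N2 - L) ≥ (Ks+1) N2/2 ≥ Ks N2/2 ≥ C s N2
    set N2 : ℝ := (n : ℝ) * (s : ℝ) ^ 2 with hN2
    set L : ℝ := (lowMass K s A B : ℝ) with hLdef
    set Co : ℝ := (coincidences A B : ℝ) with hCo
    have step1 : ((K : ℝ) * s + 1) * (N2 / 2) ≤ Co := by nlinarith
    have step2 : C * s * N2 ≤ ((K : ℝ) * s) * (N2 / 2) := by nlinarith [mul_nonneg hs0 hN0]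
    nlinarith

end TriageK3
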